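import Summits.ValiantsHypothesis.ValiantsHypothesis.Theorems.EquivariantDialNode
import Summits.ValiantsHypothesis.ValiantsHypothesis.Theorems.SymPencilSymmetrizePermPairsConjugationNormalFormSub
import Summits.ValiantsHypothesis.ValiantsHypothesis.Theorems.SymPencilSymmetrizePermPairsFiniteConjugationLiftSub
import Summits.ValiantsHypothesis.ValiantsHypothesis.Theorems.SymPencilEquivariantSdcNotQPPermEmbeddingOfYoungFixedVector
import Summits.ValiantsHypothesis.ValiantsHypothesis.Theorems.SymPencilEquivariantSdcNotQPYoungDegreeBound
import HarnessLib

/-!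
# ValiantsHypothesis — equivariant dial (decomp-valiant lens 1): the DIAGONAL NOTCH, file 1 of 2 —
# PERMIFY AT QUASI-POLYNOMIAL COST for `Δ𝔖_n`-equivariant determinantal representations of `per_n`

Support file of the sub-window dial (`EquivariantDialNotchTransfer`, cell `A = EquivariantDialNode.EqHardBiPerm`,
item `stmt-ValiantsHypothesis-23702`; `--as helper`).  It types the DIAGONAL NOTCH `diagPermSubst m ≤ biPermSubst m`
— the simultaneous substitutions `x_{ij} ↦ x_{σ i, σ j}` (Landsberg 2017 p.194, "e.g. diagonal"; the symmetry
under which Dawar–Wilsenach's square-symmetric circuits live) — and proves the TRANSFER step of the cell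
`A_Δ = EqHard diagPermSubst` (decided in file 2, `EquivariantDialDiagonalNotQP`):

★ `diag_permify` — there is `d` such that every affine determinantal representation `A` of `per_n` of size `m`
that is `Δ𝔖_n`-equivariant in the sense of Landsberg–Ressayre (EXACT `GL_m × GL_m` lifts,
`A(x_{σi,σj}) = g A(x) h⁻¹`) can be replaced by one of size `m' ≤ 2^{(log₂ m + d)^d}` on which every diagonal
substitution is undone by CONJUGATION WITH A PERMUTATION MATRIX, `A'(x_{σi,σj}) = P_τ A'(x) P_τᵀ`.

Chain (all four steps are theorems of the tree; this file only threads the diagonal through them):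
(i) conjugation normal form at the `Γ`-fixed point `J` for a SUBGROUP of permutation pairs
(`SymPencilEquivariantSdcNotQP.conjugationNormalForm_rename_sub`, crux 17793 piece (I2)) applied to the
diagonal subgroup `{(σ, σ)} ≤ 𝔖_n × 𝔖_n`; (ii′) the finite conjugation lift for a subgroup
(`….finiteConjugationLift_sub`: compressed pencil `B₀`, lift group `F ≤ (𝔖_n × 𝔖_n) × GL_{m₀}(ℂ)` over every
diagonal pair, unimodular, SCALAR fibre); (iii′) ★ `permEmbeddingQP_diag` — the permutation embedding at
quasi-polynomial cost for lift groups over the DIAGONAL, obtained from crux 17792's closed abstract embedding theorem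
`permEmbedding_of_irreducible (permEmbeddingD_of_youngFixedVector youngFixedVector_holds)` (stated for
finite groups SURJECTING onto `𝔖_n × 𝔖_n`) by INFLATION: the diagonal part `G ≤ 𝔖_n × GL_{m₀}` of the lift
group is inflated to `G × 𝔖_n ↠ 𝔖_n × 𝔖_n`, the second factor acting trivially — kernel `= ker(G → 𝔖_n) × 1`
is still scalar, so the abstract theorem applies with NO index penalty (contrast: the index-priced subgroup
permify `permify_subgroup_of_D` of crux 17793 pays `log₂ [𝔖_n × 𝔖_n : Δ] = log₂ n!`, useless here);
(iv) extension by the identity (`….exists_permConj_extension`, Weinstein–Aronszajn); budget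
`log₂ m₀ + log₂ n ≤ 2 log₂ m` (`two_mul_add_pow_le`, `n = deg per_n ≤ m`).

MODEL (non-vacuity and degenerate readings).  `Δ𝔖_n`-equivariant representations of `per_n` EXIST at every
`n ≥ 1` (restrict the Landsberg–Ressayre pairs representation, or any window-equivariant one, along
`diagPermSubst n ≤ biPermSubst n`: `hasEquivariantDetRepr_diag_of_le`), so statements about them are growth
statements, not true by absence of witnesses; at `n = 0`, `per_0 = 1` and everything is trivial; `m = 0` forces
`n = 0`.

MODEL WITNESS.  `Δ𝔖_n`-equivariant affine determinantal representations of `per_n` EXIST for every `n`: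
Landsberg–Ressayre's `G_per`-equivariant representation of size `C(2n,n) - 1` [cite: LandsbergRessayre2017,
Thm. 2.1, construction §3] restricted to `Δ𝔖_n ≤ G_per` (kernel form `hasEquivariantDetRepr_diag_of_le`; window
witnesses `EquivariantDialNode.hasEquivariantDetRepr_window_of_full`), and trivially for `n ≤ 2`.

Honest framing (LESSON 6 of the lineage): TRANSFER inside a RESTRICTED (equivariant) model — a
Landsberg–Ressayre / Dawar–Wilsenach-class statement; 0 S-currency; closes NO item; NOT a route; it proves NO
lower bound by itself (file 2 does, for the restricted model only); `EqHardBiPerm`'s residual toward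
`DcPerSuperpolynomial`, `DcPerSuperpolynomial` itself and `VP ≠ VNP` are untouched and NOT proved.
Labels: KNOWN-TYPE (LR/DW-class restricted-model lower bound) · kernel-new · TRANSFER of 17792/17793 machinery
+ ONE new move (inflation, no index penalty) · 0 S-currency · closes NO item · NOT a route · residual of every
decided notch ≡ W (LESSON 6) · P-ROW stays UNDECIDED (DW engine dead at ROW) · DcPerSuperpolynomial / MS /
VP ≠ VNP untouched.
-/

set_option linter.dupNamespace false

noncomputable section

namespace Summit.ValiantsHypothesis.ValiantsHypothesis.Theorems.EquivariantDialDiagonalPermify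

open MvPolynomial Matrix Literature.Computability.AlgebraicComplexity
open Summit.ValiantsHypothesis.ValiantsHypothesis.Theorems.EquivariantDialNode

/-! ## §1 The diagonal notch -/

/-- The DIAGONAL notch `Δ𝔖_m`: the simultaneous row-and-column substitutions `x_{ij} ↦ x_{σ i, σ j}` of the
`m²` variables (closure of the permutation matrices of `σ × σ`), as a subgroup of `GL(m²)`; the symmetry group
of Dawar–Wilsenach's square-symmetric circuits. [cite: Landsberg2017, §1.2] -/
def diagPermSubst (m : ℕ) : Subgroup (GL (Fin m × Fin m) ℂ) :=
  Subgroup.closure {γ : GL (Fin m × Fin m) ℂ | ∃ σ : Equiv.Perm (Fin m),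
    (γ : Matrix (Fin m × Fin m) (Fin m × Fin m) ℂ) = Equiv.Perm.permMatrix ℂ (Equiv.prodCongr σ σ)}

/-- The diagonal notch sits inside the window `𝔖_m × 𝔖_m`. [folklore] -/
theorem diagPermSubst_le_biPermSubst (m : ℕ) : diagPermSubst m ≤ biPermSubst m := by
  refine Subgroup.closure_mono ?_
  rintro γ ⟨σ, hγ⟩
  exact ⟨σ, σ, hγ⟩

/-- The diagonal notch is the closure over the DIAGONAL SUBGROUP `{(σ, σ)} ≤ 𝔖_m × 𝔖_m` of permutation pairs
(the currency of the subgroup lemmas of crux 17793). [folklore] -/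
theorem diagPermSubst_eq_closure_pairs (m : ℕ) :
    diagPermSubst m = Subgroup.closure {γ : GL (Fin m × Fin m) ℂ |
      ∃ πρ ∈ ((MonoidHom.id (Equiv.Perm (Fin m))).prod (MonoidHom.id (Equiv.Perm (Fin m)))).range,
        (γ : Matrix (Fin m × Fin m) (Fin m × Fin m) ℂ) =
          Equiv.Perm.permMatrix ℂ (Equiv.prodCongr πρ.1 πρ.2)} := by
  unfold diagPermSubst
  congr 1
  ext γ
  constructor
  · rintro ⟨σ, hγ⟩
    exact ⟨(σ, σ), ⟨σ, rfl⟩, hγ⟩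
  · rintro ⟨πρ, ⟨σ, hσ⟩, hγ⟩
    refine ⟨σ, ?_⟩
    rw [hγ, ← hσ]
    rfl

/-- NON-VACUITY of the model: a representation equivariant under any larger group (e.g. the window, or the
full Landsberg–Ressayre symmetry group) is `Δ𝔖_m`-equivariant. [cite: LandsbergRessayre2017, Def. 1.3] -/
theorem hasEquivariantDetRepr_diag_of_le {m s : ℕ} {Γ : Subgroup (GL (Fin m × Fin m) ℂ)}
    (hle : diagPermSubst m ≤ Γ) (h : HasEquivariantDetRepr Γ (perPoly (Fin m) ℂ) s) :
    HasEquivariantDetRepr (diagPermSubst m) (perPoly (Fin m) ℂ) s :=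
  h.anti hle

/-! ## §2 Lift groups with scalar unimodular fibre are finite -/

/-- **The lift group is finite** (generic base).  A subgroup of `Base × GL_{m₀}(ℂ)`, `Base` a finite group,
whose fibre over `1` consists of scalar matrices and all of whose matrices are unimodular is finite: the fibre
embeds into the `m₀`-th roots of unity.  (The `𝔖_n × 𝔖_n` case is crux 17792's
`finite_of_scalar_unimodular_fibre`; same proof.) [folklore] -/
theorem finite_liftGroup_of_scalar_fibre {Base : Type*} [Group Base] [Finite Base] {m₀ : ℕ}
    (F : Subgroup (Base × GL (Fin m₀) ℂ))
    (hscal : ∀ g : GL (Fin m₀) ℂ, ((1 : Base), g) ∈ F →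
      ∃ c : ℂ, (g : Matrix (Fin m₀) (Fin m₀) ℂ) = c • (1 : Matrix (Fin m₀) (Fin m₀) ℂ))
    (hdet : ∀ x ∈ F, Matrix.det (x.2 : Matrix (Fin m₀) (Fin m₀) ℂ) = 1) : Finite F := by
  classical
  set f : F →* Base := (MonoidHom.fst _ _).comp F.subtype with hf
  rw [MonoidHom.finite_iff_finite_ker_range f]
  refine ⟨?_, inferInstance⟩
  rcases Nat.eq_zero_or_pos m₀ with hm | hm
  · -- `m₀ = 0`: the matrix factor is trivial, so the kernel embeds into a point
    subst hm
    refine Finite.of_injective (fun _ : f.ker => (0 : Fin 1)) ?_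
    intro x y _
    apply Subtype.ext
    apply Subtype.ext
    have hx : ((x : F) : Base × GL (Fin 0) ℂ).1 = 1 := by
      have := x.2; rwa [MonoidHom.mem_ker] at this
    have hy : ((y : F) : Base × GL (Fin 0) ℂ).1 = 1 := by
      have := y.2; rwa [MonoidHom.mem_ker] at this
    refine Prod.ext (hx.trans hy.symm) (Units.ext (Matrix.ext fun i => Fin.elim0 i))
  · -- `m₀ ≥ 1`: kernel elements are `(1, c • 1)` with `c^{m₀} = 1`
    let i₀ : Fin m₀ := ⟨0, hm⟩
    have hker : ∀ x : f.ker, ((x : F) : Base × GL (Fin m₀) ℂ).1 = 1 :=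
      fun x => by have := x.2; rwa [MonoidHom.mem_ker] at this
    have hsc : ∀ x : f.ker, ∃ c : ℂ,
        ((((x : F) : Base × GL (Fin m₀) ℂ).2 : Matrix (Fin m₀) (Fin m₀) ℂ)) =
          c • (1 : Matrix (Fin m₀) (Fin m₀) ℂ) := by
      intro x
      apply hscal
      have hmem := (x : F).2
      have heq : ((x : F) : Base × GL (Fin m₀) ℂ) =
          ((1 : Base), ((x : F) : Base × GL (Fin m₀) ℂ).2) := Prod.ext (hker x) rfl
      rw [← heq]
      exact hmem
    refine Finite.of_injective (fun x : f.ker =>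
      (⟨((((x : F) : Base × GL (Fin m₀) ℂ).2 : Matrix (Fin m₀) (Fin m₀) ℂ)) i₀ i₀, ?_⟩ :
        {c : ℂ // c ∈ Polynomial.nthRootsFinset m₀ (1 : ℂ)})) ?_
    · obtain ⟨c, hc⟩ := hsc x
      rw [Polynomial.mem_nthRootsFinset hm, hc]
      have hd := hdet _ (x : F).2
      rw [hc, Matrix.det_smul, Matrix.det_one, mul_one, Fintype.card_fin] at hd
      simpa using hd
    · intro x y hxy
      simp only [Subtype.mk.injEq] at hxy
      obtain ⟨c, hc⟩ := hsc x
      obtain ⟨c', hc'⟩ := hsc y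
      have hcc : c = c' := by
        have h1 : ((((x : F) : Base × GL (Fin m₀) ℂ).2 : Matrix (Fin m₀) (Fin m₀) ℂ)) i₀ i₀ = c := by
          rw [hc]; simp
        have h2 : ((((y : F) : Base × GL (Fin m₀) ℂ).2 : Matrix (Fin m₀) (Fin m₀) ℂ)) i₀ i₀ = c' := by
          rw [hc']; simp
        rw [← h1, ← h2, hxy]
      apply Subtype.ext
      apply Subtype.ext
      refine Prod.ext ((hker x).trans (hker y).symm) (Units.ext ?_)
      rw [hc, hc', hcc]

/-! ## §3 Permutation embedding over the diagonal, by inflation -/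

/-- ★ **(iii′)_Δ — permutation embedding at quasi-polynomial cost for lift groups over the DIAGONAL.**
For every `F ≤ (𝔖_n × 𝔖_n) × GL_{m₀}(ℂ)` containing an element over every diagonal pair `(σ, σ)`, with
unimodular matrices and scalar fibre over `(1, 1)`, the `F`-module `ℂ^{m₀}` is an equivariant retract
(`p ι = 1`, `P_τ ι = ι g`, `p P_τ = g p`) of a permutation module of dimension `≤ 2^{(log₂ m₀ + log₂ n + d)^d}`
along the diagonal elements of `F`.  Proof: INFLATION — apply crux 17792's abstract embedding theorem to
`G × 𝔖_n ↠ 𝔖_n × 𝔖_n`, `(x, κ) ↦ (pr x, κ)`, `ρ (x, κ) = x.2`, where `G = {(σ, g) : ((σ, σ), g) ∈ F}` is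
finite (`finite_liftGroup_of_scalar_fibre`) and the kernel `ker(pr) × 1` acts by scalars. [folklore] -/
theorem permEmbeddingQP_diag : ∃ d : ℕ, ∀ (n m₀ : ℕ)
    (F : Subgroup ((Equiv.Perm (Fin n) × Equiv.Perm (Fin n)) × GL (Fin m₀) ℂ)),
    (∀ σ : Equiv.Perm (Fin n), ∃ g : GL (Fin m₀) ℂ, ((σ, σ), g) ∈ F) →
    (∀ g : GL (Fin m₀) ℂ, ((1 : Equiv.Perm (Fin n) × Equiv.Perm (Fin n)), g) ∈ F →
      ∃ c : ℂ, (g : Matrix (Fin m₀) (Fin m₀) ℂ) = c • (1 : Matrix (Fin m₀) (Fin m₀) ℂ)) →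
    (∀ x ∈ F, Matrix.det (x.2 : Matrix (Fin m₀) (Fin m₀) ℂ) = 1) →
    ∃ m' ≤ 2 ^ ((Nat.log 2 m₀ + Nat.log 2 n + d) ^ d),
      ∃ (ι : Matrix (Fin m') (Fin m₀) ℂ) (p : Matrix (Fin m₀) (Fin m') ℂ)
        (τ : (Equiv.Perm (Fin n) × Equiv.Perm (Fin n)) × GL (Fin m₀) ℂ → Equiv.Perm (Fin m')),
        p * ι = 1 ∧ ∀ (σ : Equiv.Perm (Fin n)) (g : GL (Fin m₀) ℂ), ((σ, σ), g) ∈ F →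
          (τ ((σ, σ), g)).permMatrix ℂ * ι = ι * (g : Matrix (Fin m₀) (Fin m₀) ℂ) ∧
          p * (τ ((σ, σ), g)).permMatrix ℂ = (g : Matrix (Fin m₀) (Fin m₀) ℂ) * p := by
  classical
  obtain ⟨d, hd⟩ := SymPencilEquivariantSdcNotQP.permEmbedding_of_irreducible
    (SymPencilEquivariantSdcNotQP.permEmbeddingD_of_youngFixedVector
      SymPencilEquivariantSdcNotQP.YoungBounds.youngFixedVector_holds)
  refine ⟨d, fun n m₀ F hsurj hscal hdet => ?_⟩
  -- the diagonal part of the lift group, as a subgroup over `𝔖_n`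
  let δ : Equiv.Perm (Fin n) →* Equiv.Perm (Fin n) × Equiv.Perm (Fin n) :=
    (MonoidHom.id (Equiv.Perm (Fin n))).prod (MonoidHom.id (Equiv.Perm (Fin n)))
  let G : Subgroup (Equiv.Perm (Fin n) × GL (Fin m₀) ℂ) :=
    F.comap (δ.prodMap (MonoidHom.id (GL (Fin m₀) ℂ)))
  have hmemG : ∀ x : Equiv.Perm (Fin n) × GL (Fin m₀) ℂ, x ∈ G ↔ ((x.1, x.1), x.2) ∈ F :=
    fun x => Iff.rfl
  haveI : Finite G := finite_liftGroup_of_scalar_fibre G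
    (fun g hg => hscal g ((hmemG (1, g)).1 hg)) (fun x hx => hdet _ ((hmemG x).1 hx))
  -- inflation: `G × 𝔖_n ↠ 𝔖_n × 𝔖_n`, the second factor acting trivially
  let φ : ↥G × Equiv.Perm (Fin n) →* Equiv.Perm (Fin n) × Equiv.Perm (Fin n) :=
    ((MonoidHom.fst _ _).comp G.subtype).prodMap (MonoidHom.id (Equiv.Perm (Fin n)))
  let ρ : ↥G × Equiv.Perm (Fin n) →* GL (Fin m₀) ℂ :=
    ((MonoidHom.snd _ _).comp G.subtype).comp (MonoidHom.fst _ _)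
  have hφapp : ∀ x : ↥G × Equiv.Perm (Fin n),
      φ x = ((x.1 : Equiv.Perm (Fin n) × GL (Fin m₀) ℂ).1, x.2) := fun x => rfl
  have hρapp : ∀ x : ↥G × Equiv.Perm (Fin n),
      ρ x = (x.1 : Equiv.Perm (Fin n) × GL (Fin m₀) ℂ).2 := fun x => rfl
  have hφs : Function.Surjective φ := by
    rintro ⟨σ, κ⟩
    obtain ⟨g, hg⟩ := hsurj σ
    exact ⟨(⟨(σ, g), (hmemG (σ, g)).2 hg⟩, κ), rfl⟩
  have hker : ∀ x : ↥G × Equiv.Perm (Fin n), φ x = 1 →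
      ∃ c : ℂ, (ρ x : Matrix (Fin m₀) (Fin m₀) ℂ) = c • (1 : Matrix (Fin m₀) (Fin m₀) ℂ) := by
    intro x hx
    rw [hφapp, Prod.mk_eq_one] at hx
    rw [hρapp]
    apply hscal
    have hmem : (((x.1 : Equiv.Perm (Fin n) × GL (Fin m₀) ℂ).1,
        (x.1 : Equiv.Perm (Fin n) × GL (Fin m₀) ℂ).1),
        (x.1 : Equiv.Perm (Fin n) × GL (Fin m₀) ℂ).2) ∈ F := (hmemG _).1 x.1.2
    rw [hx.1] at hmem
    exact hmem
  have hdet' : ∀ x : ↥G × Equiv.Perm (Fin n), Matrix.det (ρ x : Matrix (Fin m₀) (Fin m₀) ℂ) = 1 :=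
    fun x => hdet _ ((hmemG _).1 x.1.2)
  obtain ⟨m', hm', ι, p, τ, hpι, hrel⟩ := hd n m₀ (↥G × Equiv.Perm (Fin n)) φ ρ hφs hker hdet'
  refine ⟨m', hm', ι, p, fun x => if hx : ((x.1.1, x.1.1), x.2) ∈ F then
    τ (⟨(x.1.1, x.2), (hmemG (x.1.1, x.2)).2 hx⟩, 1) else 1, hpι, fun σ g hg => ?_⟩
  dsimp only
  rw [dif_pos hg]
  exact hrel (⟨(σ, g), (hmemG (σ, g)).2 hg⟩, 1)

/-! ## §4 Diagonal permify -/

/-- ★ **DIAGONAL PERMIFY.**  There is `d` such that every `Δ𝔖_n`-equivariant (exact `GL_m × GL_m` lifts)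
affine determinantal representation of `per_n` of size `m` yields one of size `m' ≤ 2^{(log₂ m + d)^d}` on
which every diagonal substitution `x_{ij} ↦ x_{σ i, σ j}` is undone by conjugation with a permutation matrix.
Steps (i) `conjugationNormalForm_rename_sub` and (ii′) `finiteConjugationLift_sub` over the diagonal subgroup
of pairs, (iii′) `permEmbeddingQP_diag`, (iv) `exists_permConj_extension`; budget `two_mul_add_pow_le`.
TRANSFER inside the restricted model; 0 S-currency; closes NO item. [folklore] -/
theorem diag_permify : ∃ d : ℕ, ∀ (n m : ℕ)
    (A : Matrix (Fin m) (Fin m) (MvPolynomial (Fin n × Fin n) ℂ)),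
    IsEquivariantDetRepr (diagPermSubst n) (perPoly (Fin n) ℂ) A →
    ∃ m' ≤ 2 ^ ((Nat.log 2 m + d) ^ d),
      ∃ A' : Matrix (Fin m') (Fin m') (MvPolynomial (Fin n × Fin n) ℂ),
        IsAffineDetRepr (perPoly (Fin n) ℂ) A' ∧
        ∀ σ : Equiv.Perm (Fin n), ∃ τ : Equiv.Perm (Fin m'),
          A'.map (MvPolynomial.rename fun ij : Fin n × Fin n => (σ ij.1, σ ij.2)) =
            (τ.permMatrix ℂ).map MvPolynomial.C * A' * ((τ.permMatrix ℂ)ᵀ).map MvPolynomial.C := by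
  classical
  obtain ⟨d, hd⟩ := permEmbeddingQP_diag
  refine ⟨2 * d + 2, fun n m A hA => ?_⟩
  -- `n = deg per_n ≤ m`
  have hnm : n ≤ m := by
    have h := totalDegree_le_of_hasDetRepr_holds
      (show HasDetRepr (perPoly (Fin n) ℂ) m from ⟨A, hA.1⟩)
    rwa [totalDegree_perPoly_holds, Fintype.card_fin] at h
  -- the diagonal subgroup of pairs
  let Δ : Subgroup (Equiv.Perm (Fin n) × Equiv.Perm (Fin n)) :=
    ((MonoidHom.id (Equiv.Perm (Fin n))).prod (MonoidHom.id (Equiv.Perm (Fin n)))).range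
  have hmemΔ : ∀ σ : Equiv.Perm (Fin n), (σ, σ) ∈ Δ := fun σ => ⟨σ, rfl⟩
  have hA' : IsEquivariantDetRepr (Subgroup.closure {γ : GL (Fin n × Fin n) ℂ |
      ∃ πρ ∈ Δ, (γ : Matrix (Fin n × Fin n) (Fin n × Fin n) ℂ) =
        Equiv.Perm.permMatrix ℂ (Equiv.prodCongr πρ.1 πρ.2)}) (perPoly (Fin n) ℂ) A := by
    rw [← diagPermSubst_eq_closure_pairs]
    exact hA
  -- step (i): conjugation normal form over the diagonal subgroup
  obtain ⟨B, hB, hBJ, hgen⟩ :=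
    SymPencilEquivariantSdcNotQP.conjugationNormalForm_rename_sub n m Δ A hA'
  -- step (ii′): finite conjugation lift over the diagonal subgroup
  obtain ⟨m₀, hm₀, B₀, F, hB₀, hsurj, hscal, hdet, hliftF⟩ :=
    SymPencilEquivariantSdcNotQP.finiteConjugationLift_sub n m Δ B hB hBJ hgen
  -- step (iii′): permutation embedding over the diagonal (inflation)
  obtain ⟨m', hm', ι, p, τ, hpι, hrel⟩ :=
    hd n m₀ F (fun σ => hsurj (σ, σ) (hmemΔ σ)) hscal hdet
  -- step (iv): extension by the identity
  obtain ⟨A', hA'deg, hA'det, hA'perm⟩ := SymPencilEquivariantSdcNotQP.exists_permConj_extension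
    (fun σ : Equiv.Perm (Fin n) =>
      MvPolynomial.rename fun ij : Fin n × Fin n => (σ ij.1, σ ij.2))
    B₀ hB₀.1 ι p hpι (fun σ => by
      obtain ⟨g, hg⟩ := hsurj (σ, σ) (hmemΔ σ)
      exact ⟨g, τ ((σ, σ), g), hliftF ((σ, σ), g) hg, (hrel σ g hg).1, (hrel σ g hg).2⟩)
  refine ⟨m', ?_, A', ⟨hA'deg, hA'det.trans hB₀.2⟩, fun σ => hA'perm σ⟩
  -- budget: `log₂ m₀ + log₂ n ≤ 2 log₂ m`
  have hlog : Nat.log 2 m₀ + Nat.log 2 n + d ≤ 2 * Nat.log 2 m + d := by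
    have h1 := Nat.log_mono_right (b := 2) hm₀
    have h2 := Nat.log_mono_right (b := 2) hnm
    omega
  calc m' ≤ 2 ^ ((Nat.log 2 m₀ + Nat.log 2 n + d) ^ d) := hm'
    _ ≤ 2 ^ ((2 * Nat.log 2 m + d) ^ d) :=
        Nat.pow_le_pow_right (by norm_num) (Nat.pow_le_pow_left hlog d)
    _ ≤ 2 ^ ((Nat.log 2 m + (2 * d + 2)) ^ (2 * d + 2)) :=
        Nat.pow_le_pow_right (by norm_num) (SymPencilEquivariantSdcNotQP.two_mul_add_pow_le _ _)

end Summit.ValiantsHypothesis.ValiantsHypothesis.Theorems.EquivariantDialDiagonalPermify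

end
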